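import Summits.ResolutionOfSingularities.ResolutionOfSingularities.Theorems.HilbertSamuelEliminationSigmaMaxModificationsCorridor3CPFramePointChart
import Summits.ResolutionOfSingularities.ResolutionOfSingularities.Theorems.HilbertSamuelEliminationSigmaMaxModificationsCorridor3CPFrameChartTransition
import Summits.ResolutionOfSingularities.ResolutionOfSingularities.Theorems.HilbertSamuelEliminationSigmaMaxModificationsCorridor3CPFrameChartRegular
import Summits.ResolutionOfSingularities.ResolutionOfSingularities.Theorems.HilbertSamuelEliminationSigmaMaxModificationsCorridor3CPFrameHypersurfaceReading
import Summits.ResolutionOfSingularities.ResolutionOfSingularities.Theorems.HilbertSamuelEliminationSigmaMaxModificationsCorridor3WLadderCPFramePolynomialChart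
import HarnessLib

/-!
# [OURS · L1 W4.2] D18 G5 (ii-b): from the chart presentation at a point over `x_n` (G2) to a presentation on the TRANSFORMED FRAME
# `R[𝔪/u_{j₀}][X']/(h')` at a prime over `𝔪_R` (point-centre case `J = 𝔪`)
# (cell res-hironaka, LADDER-RESOLUTION rung L; slot W4.2, crux chain w42 `SigmaMaxModificationsCorridor3` stmt-ResolutionOfSingularities-19249;
# `--supports stmt-ResolutionOfSingularities-19249 --as helper`; hand res-D-brk-3 (gen 6), cut G5 of TAKING 13:03:41Z)

PURE COMMUTATIVE ALGEBRA, 0 `def`s, every declaration PROVED; OURS bookkeeping; NOT a statement of Hironaka's manuscript [Hironaka2017] nor of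
[CossartJannsenSaito2020]/[CossartPiltant2019]. AI-written, weaker than expert review.

* `presentation_comp_ringEquiv` — the four presentation clauses (flat, local, `𝔪 ↦ 𝔪` onto, residue-onto) survive post-composition with a ring
  isomorphism.
* **`exists_adjoinRoot_chart_presentation`** — `R` regular local of dimension `n` with r.s.p. `u`, `h ∈ R[X]` monic of degree `m ≥ 1` with
  `coeff_i h ∈ 𝔪_R^{m−i}`, `B = R[X]/(h)` (local); `J = (ū, x)·B` (`= 𝔪_B`, the POINT centre read in the frame), `g ∈ J` a chart denominator,
  `𝔔'` a prime of `B[J/g]` over `J`, `ψ' : O₀ → (B[J/g])_{𝔔'}` a presentation (G2's output). THEN for some `j₀` (G3b: a `u_{j₀}`-chart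
  contains the point), with `S = R[(u)/u_{j₀}]` and `h' ∈ S[X]` the monic transform (p526498), there are a prime `𝔔₃` of `S[X]/(h')` whose
  contraction to `R` is `𝔪_R` and a presentation `ψ₃ : O₀ → (S[X]/(h'))_{𝔔₃}` (G3a chart transition + the ring isomorphism
  `S[X]/(h') ≅ B[J/ū_{j₀}]` + localisation transport). Next file: NearShape/LocalChart/completion/minimality on this output.

References: Stacks 0804/0805 [StacksProject]; CP 2019 Prop. 2.6 [CossartPiltant2019]; tree G1–G5(i)(ii-a), 050's p526498.
-/

noncomputable section

set_option linter.dupNamespace false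

open IsLocalRing IsLocalization Polynomial
open Literature.AlgebraicGeometry.Resolution
open Summit.ResolutionOfSingularities.ResolutionOfSingularities.Theorems.SigmaMaxModificationsCorridor3.Moving

universe u

namespace Summit.ResolutionOfSingularities.ResolutionOfSingularities.Theorems.SigmaMaxModificationsCorridor3.Helpers

/-! ## Presentations and ring isomorphisms -/

/-- The presentation clauses survive post-composition with a ring isomorphism of local rings. [folklore] -/
theorem presentation_comp_ringEquiv {O T T' : Type*} [CommRing O] [CommRing T] [CommRing T'] [IsLocalRing O] [IsLocalRing T]
    [IsLocalRing T'] (ψ : O →+* T) (hflat : ψ.Flat) (hloc : IsLocalHom ψ) (hmap : (maximalIdeal O).map ψ = maximalIdeal T)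
    (hres : Function.Surjective ((residue T).comp ψ)) (e : T ≃+* T') :
    ((e : T →+* T').comp ψ).Flat ∧ IsLocalHom ((e : T →+* T').comp ψ) ∧
      (maximalIdeal O).map ((e : T →+* T').comp ψ) = maximalIdeal T' ∧
      Function.Surjective ((residue T').comp ((e : T →+* T').comp ψ)) := by
  haveI := hloc
  refine ⟨RingHom.Flat.comp hflat (RingHom.Flat.of_bijective e.bijective), RingHom.isLocalHom_comp _ _, ?_, fun ρ => ?_⟩
  · rw [← Ideal.map_map, hmap]
    exact map_maximalIdeal_of_bijective _ e.bijective
  · obtain ⟨y, rfl⟩ := residue_surjective ρ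
    obtain ⟨o, ho⟩ := hres (residue T (e.symm y))
    refine ⟨o, ?_⟩
    rw [RingHom.comp_apply] at ho
    rw [RingHom.comp_apply, RingHom.comp_apply, RingHom.coe_coe]
    apply Ideal.Quotient.eq.mpr
    have h1 : ψ o - e.symm y ∈ maximalIdeal T := Ideal.Quotient.eq.mp ho
    have h2 : e (ψ o - e.symm y) ∈ maximalIdeal T' :=
      (IsLocalRing.mem_maximalIdeal _).mpr fun hu =>
        (IsLocalRing.mem_maximalIdeal _).mp h1 ((MulEquiv.isUnit_map e).mp hu)
    rwa [map_sub, e.apply_symm_apply] at h2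

/-! ## From the chart presentation over `x_n` to the transformed frame -/

set_option maxHeartbeats 1600000 in
-- many subalgebra / localisation coercions (affine blowup algebras of a quotient of a polynomial ring); elaboration is slow
/-- [OURS · L1 W4.2] **The presentation at a point over `x_n`, read on the transformed frame `R[(u)/u_{j₀}][X']/(h')`** (point centre). See the
module docstring. [cite: StacksProject, Tag 0804] [cite: CossartPiltant2019, Prop. 2.6 and (2.7) (arXiv v1 pp. 13–14)] -/
theorem exists_adjoinRoot_chart_presentation {R : Type u} [CommRing R] [IsRegularLocalRing R] {n : ℕ} (hdim : ringKrullDim R = n)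
    (u : Fin n → R) (hu : Ideal.span (Set.range u) = maximalIdeal R) {h : R[X]} (hmo : h.Monic) (hm : 0 < h.natDegree)
    (hco : ∀ i < h.natDegree, h.coeff i ∈ maximalIdeal R ^ (h.natDegree - i)) [IsLocalRing (R[X] ⧸ Ideal.span {h})]
    (J : Ideal (R[X] ⧸ Ideal.span {h}))
    (hJ : J = ((Ideal.span (Set.range u)).map (C : R →+* R[X]) ⊔ Ideal.span {X}).map (Ideal.Quotient.mk (Ideal.span {h})))
    {g : R[X] ⧸ Ideal.span {h}} (hg : g ∈ J) (𝔔' : Ideal (blowupAlgebra J g)) [𝔔'.IsPrime]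
    (h𝔔' : 𝔔'.comap (algebraMap (R[X] ⧸ Ideal.span {h}) (blowupAlgebra J g)) = J)
    {O₀ : Type u} [CommRing O₀] [IsLocalRing O₀] (ψ' : O₀ →+* Localization.AtPrime 𝔔')
    (hflat : @RingHom.Flat O₀ (Localization.AtPrime 𝔔') _ _ ψ') (hloc : IsLocalHom ψ')
    (hmap : (maximalIdeal O₀).map ψ' = maximalIdeal (Localization.AtPrime 𝔔'))
    (hres : Function.Surjective ((residue (Localization.AtPrime 𝔔')).comp ψ')) :
    ∃ (j₀ : Fin n) (h' : (blowupAlgebra (Ideal.span (Set.range u)) (u j₀))[X]) (𝔔₃ : Ideal (AdjoinRoot h')) (_ : 𝔔₃.IsPrime)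
      (ψ₃ : O₀ →+* Localization.AtPrime 𝔔₃),
      h'.Monic ∧ h'.natDegree = h.natDegree ∧
      (∀ i ∈ Finset.Icc 1 h.natDegree, h'.coeff (h.natDegree - i) *
        algebraMap R (blowupAlgebra (Ideal.span (Set.range u)) (u j₀)) (u j₀) ^ i =
          algebraMap R (blowupAlgebra (Ideal.span (Set.range u)) (u j₀)) (h.coeff (h.natDegree - i))) ∧
      ((𝔔₃.comap (AdjoinRoot.mk h')).comap C).comap (algebraMap R (blowupAlgebra (Ideal.span (Set.range u)) (u j₀))) = maximalIdeal R ∧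
      @RingHom.Flat O₀ (Localization.AtPrime 𝔔₃) _ _ ψ₃ ∧ IsLocalHom ψ₃ ∧
      (maximalIdeal O₀).map ψ₃ = maximalIdeal (Localization.AtPrime 𝔔₃) ∧
      Function.Surjective ((residue (Localization.AtPrime 𝔔₃)).comp ψ₃) := by
  subst hJ
  -- the frame ring is local with maximal ideal `(((Ideal.span (Set.range u)).map (C : R →+* R[X]) ⊔ Ideal.span {X}).map (Ideal.Quotient.mk (Ideal.span {h})))`
  haveI : IsLocalRing (AdjoinRoot h) := ‹IsLocalRing (R[X] ⧸ Ideal.span {h})›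
  obtain ⟨_, hmaxB⟩ := exists_isLocalRing_adjoinRoot_of_coeff_mem hmo hm (fun i hi => Ideal.pow_le_self (by omega) (hco i hi))
  have hmaxB' : maximalIdeal (R[X] ⧸ Ideal.span {h}) = (((Ideal.span (Set.range u)).map (C : R →+* R[X]) ⊔ Ideal.span {X}).map (Ideal.Quotient.mk (Ideal.span {h}))) := by
    have h1 : maximalIdeal (AdjoinRoot h) = (maximalIdeal R).map (AdjoinRoot.of h) ⊔ Ideal.span {AdjoinRoot.root h} := hmaxB
    rw [Ideal.map_sup, Ideal.map_map, Ideal.map_span _ {X}, Set.image_singleton, hu]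
    exact h1
  have hcomapR : ((((Ideal.span (Set.range u)).map (C : R →+* R[X]) ⊔ Ideal.span {X}).map (Ideal.Quotient.mk (Ideal.span {h}))).comap (Ideal.Quotient.mk (Ideal.span {h}))).comap C = maximalIdeal R := by
    rw [← hmaxB']
    exact comap_C_comap_mk_maximalIdeal (h := h) hmo
  -- the generators `w = x`, `v_j = ū_j` of `(((Ideal.span (Set.range u)).map (C : R →+* R[X]) ⊔ Ideal.span {X}).map (Ideal.Quotient.mk (Ideal.span {h})))` and the monic relation
  set w : (R[X] ⧸ Ideal.span {h}) := Ideal.Quotient.mk (Ideal.span {h}) X with hw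
  set v : Fin n → (R[X] ⧸ Ideal.span {h}) := fun j => Ideal.Quotient.mk (Ideal.span {h}) (C (u j)) with hv
  have hwJ : w ∈ (((Ideal.span (Set.range u)).map (C : R →+* R[X]) ⊔ Ideal.span {X}).map (Ideal.Quotient.mk (Ideal.span {h}))) := Ideal.mem_map_of_mem _ (Ideal.mem_sup_right (Ideal.subset_span rfl))
  have hvJ : ∀ j, v j ∈ (((Ideal.span (Set.range u)).map (C : R →+* R[X]) ⊔ Ideal.span {X}).map (Ideal.Quotient.mk (Ideal.span {h}))) := fun j =>
    Ideal.mem_map_of_mem _ (Ideal.mem_sup_left (Ideal.mem_map_of_mem _ (Ideal.subset_span ⟨j, rfl⟩)))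
  have hspanv : Ideal.span (Set.range v) = (Ideal.span (Set.range u)).map ((Ideal.Quotient.mk (Ideal.span {h})).comp C) := by
    rw [Ideal.map_span, ← Set.range_comp]
    rfl
  have hJPeq : (((Ideal.span (Set.range u)).map (C : R →+* R[X]) ⊔ Ideal.span {X}).map (Ideal.Quotient.mk (Ideal.span {h}))) = Ideal.span (insert w (Set.range v)) := by
    rw [Ideal.span_insert, hspanv, Ideal.map_sup, Ideal.map_map, Ideal.map_span _ {X}, Set.image_singleton, sup_comm]
  have hrel : w ^ h.natDegree + ∑ i ∈ Finset.range h.natDegree, Ideal.Quotient.mk (Ideal.span {h}) (C (h.coeff i)) * w ^ i = 0 := by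
    have h1 : Ideal.Quotient.mk (Ideal.span {h}) (X ^ h.natDegree + ∑ i ∈ Finset.range h.natDegree, C (h.coeff i) * X ^ i) = 0 := by
      rw [← hmo.as_sum, Ideal.Quotient.eq_zero_iff_mem]
      exact Ideal.subset_span rfl
    rw [map_add, map_pow, map_sum] at h1
    simp_rw [map_mul, map_pow] at h1
    exact h1
  have hc : ∀ i < h.natDegree, Ideal.Quotient.mk (Ideal.span {h}) (C (h.coeff i)) ∈ Ideal.span (Set.range v) ^ (h.natDegree - i) := by
    intro i hi
    rw [hspanv, ← Ideal.map_pow, hu]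
    exact Ideal.mem_map_of_mem _ (hco i hi)
  -- G3b: some `ū_{j₀}/g ∉ 𝔔'`
  obtain ⟨j₀, hj₀⟩ := blowupAlgebra.exists_div_not_mem_of_relation (((Ideal.span (Set.range u)).map (C : R →+* R[X]) ⊔ Ideal.span {X}).map (Ideal.Quotient.mk (Ideal.span {h}))) hwJ hvJ (hJPeq ▸ hg) hc hrel 𝔔'
  -- G3a: move to the `ū_{j₀}`-chart
  obtain ⟨𝔔'', h𝔔''p, -, hiff, e₁, -⟩ :=
    blowupAlgebra.exists_atPrime_ringEquiv_of_not_mem (((Ideal.span (Set.range u)).map (C : R →+* R[X]) ⊔ Ideal.span {X}).map (Ideal.Quotient.mk (Ideal.span {h}))) hg (hvJ j₀) 𝔔' hj₀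
  have h𝔔''c : 𝔔''.comap (algebraMap (R[X] ⧸ Ideal.span {h}) (blowupAlgebra (((Ideal.span (Set.range u)).map (C : R →+* R[X]) ⊔ Ideal.span {X}).map (Ideal.Quotient.mk (Ideal.span {h}))) (v j₀))) = (((Ideal.span (Set.range u)).map (C : R →+* R[X]) ⊔ Ideal.span {X}).map (Ideal.Quotient.mk (Ideal.span {h}))) := by
    ext r
    rw [Ideal.mem_comap, hiff, ← Ideal.mem_comap, h𝔔']
  -- the monic transform and the chart isomorphism (p526498)
  have hrsop : IsRsopPart u := isRsopPart_of_span_range_eq_maximalIdeal hdim u hu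
  have key := exists_monic_transform_ringEquiv u (J := Finset.univ) (j₀ := j₀) hmo
    (fun i hi => by
      rw [Finset.coe_univ, Set.image_univ, hu]
      have hi' := Finset.mem_Icc.mp hi
      have := hco (h.natDegree - i) (by omega)
      rwa [show h.natDegree - (h.natDegree - i) = i by omega] at this)
    (by rw [Finset.coe_univ, Set.image_univ]; exact prime_algebraMap_blowupAlgebra_of_isRsopPart hrsop j₀)
  rw [Finset.coe_univ, Set.image_univ] at key
  obtain ⟨h', hmon', hdeg', hcoef', e, he⟩ := key
  -- the prime on `S[X]/(h')` and the transported localisation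
  set 𝔔₃ : Ideal (AdjoinRoot h') := 𝔔''.comap (e : AdjoinRoot h' →+* blowupAlgebra (((Ideal.span (Set.range u)).map (C : R →+* R[X]) ⊔ Ideal.span {X}).map (Ideal.Quotient.mk (Ideal.span {h}))) (v j₀)) with h𝔔₃
  haveI h𝔔₃p : 𝔔₃.IsPrime := Ideal.comap_isPrime _ _
  have hM : 𝔔₃.primeCompl.map e.toMonoidHom = 𝔔''.primeCompl := by
    ext y
    simp only [Submonoid.mem_map, Ideal.mem_primeCompl_iff]
    constructor
    · rintro ⟨x, hx, rfl⟩
      exact fun hy => hx (Ideal.mem_comap.mpr hy)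
    · intro hy
      refine ⟨e.symm y, fun hx => hy ?_, e.apply_symm_apply y⟩
      have := Ideal.mem_comap.mp hx
      rwa [RingHom.coe_coe, e.apply_symm_apply] at this
  let e₃ : Localization.AtPrime 𝔔₃ ≃+* Localization.AtPrime 𝔔'' :=
    IsLocalization.ringEquivOfRingEquiv (M := 𝔔₃.primeCompl) (T := 𝔔''.primeCompl) (Localization.AtPrime 𝔔₃)
      (Localization.AtPrime 𝔔'') e hM
  -- the presentation on the transformed frame
  obtain ⟨hf₁, hl₁, hm₁, hr₁⟩ := presentation_comp_ringEquiv (T := Localization.AtPrime 𝔔') (T' := Localization.AtPrime 𝔔'')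
    ψ' hflat hloc hmap hres e₁
  obtain ⟨hf₂, hl₂, hm₂, hr₂⟩ := presentation_comp_ringEquiv (T := Localization.AtPrime 𝔔'') (T' := Localization.AtPrime 𝔔₃)
    _ hf₁ hl₁ hm₁ hr₁ e₃.symm
  refine ⟨j₀, h', 𝔔₃, h𝔔₃p, _, hmon', hdeg', hcoef', ?_, hf₂, hl₂, hm₂, hr₂⟩
  -- `𝔔₃` lies over `𝔪_R`
  ext r
  have h1 := he (C r)
  rw [eval₂_C, RingHom.comp_apply] at h1
  have h2 := (SetLike.ext_iff.mp h𝔔''c (Ideal.Quotient.mk (Ideal.span {h}) (C r))).symm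
  rw [Ideal.mem_comap, Ideal.mem_comap, Ideal.mem_comap, h𝔔₃, Ideal.mem_comap, RingHom.coe_coe, ← hcomapR, Ideal.mem_comap,
    Ideal.mem_comap, h2, Ideal.mem_comap, h1]

end Summit.ResolutionOfSingularities.ResolutionOfSingularities.Theorems.SigmaMaxModificationsCorridor3.Helpers

end
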